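/-
Copyright (c) 2026 the pub-hodgecm-mathlib formalisation cell (harness21).  Prover seat hodgecm-mathlib-K2E3-p23 (g4), Track B «K2-LIT» ∕ h413
(`stmt-HodgeConjecture-24833`), line `K2_E3_EllipticInputs`, (SC-an) road «FC» (line lead K2E3-p14 (g4), RULINGS #15 ∕ MAP v5), brick (FC-8a).  2026-09-04.
-/
import Mathlib.MeasureTheory.Group.LIntegral
import Mathlib.MeasureTheory.Measure.Prod
import HarnessLib

/-!
# Crux `H413` — K2-LIT E3, (SC-an) road «FC» (finite conjugation measure), brick (FC-8a): THE TONELLI + CARTAN-COVER SKELETON OF STEP (i) —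
# `∫_{A} ∫_G β(x g x⁻¹) dμ(x) dμ(g) ≤ ‖β‖_∞ · Σ_d μ(D_d) · sup_{x ∈ D_d} μ(A ∩ x⁻¹ S x)`

Cell `hodgecm-mathlib`, Track B, line `K2_E3_EllipticInputs`, socket U12 :255 (SC-an) via road «FC» of K2E3-p14 (g4) (RULINGS #15, step (i): «Tonelli in `x` first
+ ★ CARTAN `U = ⋃_d K₀ t_d K₀`: `I ≤ ‖β‖_∞ Σ_d μ(K₀t_dK₀) · sup_{x ∈ K₀t_dK₀} μ(C ∩ Φ_β ∩ x⁻¹(supp β)x)`»); seat K2E3-p23 (g4).  THEOREMS ONLY, Mathlib-pure;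
count-neutral helper (`--supports stmt-HodgeConjecture-24833 --as helper`).

THE MATHEMATICS (generic measure theory; the group enters only through the conjugation map).  `G` a group with measurable multiplication and inversion
(`MeasurableMul₂`, `MeasurableInv` — automatic for a second-countable Borel topological group), `μ` an s-finite measure on `G`.
* `lintegral_le_tsum_measure_mul_iSup_mem` — **COVER BOUND**: for a countable measurable cover `G = ⋃_d D_d` and ANY `F ≥ 0`,
  `∫ F dμ ≤ Σ_d μ(D_d) · ⨆_{x ∈ D_d} F(x)` (`∫_{⋃} ≤ Σ ∫_{D_d}` and `∫_{D_d} F ≤ μ(D_d) · sup_{D_d} F`).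
* `setLIntegral_conj_le_mul_measure` — **FIBRE BOUND**: `β ≤ M_b`, `β = 0` off `S` ⇒ `∫_{g ∈ A} β(x g x⁻¹) dμ(g) ≤ M_b · μ(A ∩ {g | x g x⁻¹ ∈ S})` (each `x`).
* `setLIntegral_lintegral_conj_eq` — **TONELLI**: `∫_{g ∈ A} ∫_x β(x g x⁻¹) dμ dμ = ∫_x ∫_{g ∈ A} β(x g x⁻¹) dμ dμ` (`β` measurable, `μ` s-finite).
* `setLIntegral_lintegral_conj_le` — the two combined: `∫_{A} ∫_G β(x g x⁻¹) dμ(x) dμ(g) ≤ ∫_x M_b · μ(A ∩ {g | x g x⁻¹ ∈ S}) dμ(x)`.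
* `setLIntegral_lintegral_conj_le_tsum` — **STEP (i) OF (R15-1)**: with a countable measurable cover `(D_d)` (the Cartan double cosets `K₀ t_d K₀`),
  `∫_{A} ∫_G β(x g x⁻¹) dμ(x) dμ(g) ≤ M_b · Σ_d μ(D_d) · ⨆_{x ∈ D_d} μ(A ∩ {g | x g x⁻¹ ∈ S})` (`A = C ∩ Φ_β`, `S = supp β`).

HONEST LABEL: HC_CM is proved only modulo the 7 printed citations (2 remaining named inputs: hLiu418 = stmt-HodgeConjecture-24832, h413 =
stmt-HodgeConjecture-24833) until rung 0 closes; elementary measure theory, closes no organ by itself ((SC-an) is NOT ★; road «FC» pays `hballE` only when its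
bricks + (M5h‴) land).

## References
* [Folland1995] G. B. Folland, *A Course in Abstract Harmonic Analysis* (1995), §2.2–§2.4 (Haar integral, Tonelli on groups).
* [Helgason2000] S. Helgason, *Groups and Geometric Analysis* (2000), Ch. I §1 No. 1–2, §5 (integral formulas for the Cartan decomposition).
-/

set_option autoImplicit false
-- the mandated namespace repeats `HodgeConjecture.HodgeConjecture`, as in every `Theorems/*.lean` of this sub-problem
set_option linter.dupNamespace false

noncomputable section

open MeasureTheory MeasureTheory.Measure Set Function
open scoped ENNReal

namespace Summit.HodgeConjecture.HodgeConjecture.Cruxes.H413.K2E3ConjFibreCoverSkeleton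

variable {G : Type*} [MeasurableSpace G]

/-- **COVER BOUND `∫ F dμ ≤ Σ_d μ(D_d) · ⨆_{x ∈ D_d} F(x)`** for a countable measurable cover `⋃_d D_d = G` and any `F ≥ 0` (no measurability of `F`
needed: `∫_{⋃_d D_d} ≤ Σ_d ∫_{D_d}` and `∫_{D_d} F ≤ μ(D_d)·sup_{D_d} F`). [folklore] -/
theorem lintegral_le_tsum_measure_mul_iSup_mem {ι : Type*} [Countable ι] (μ : Measure G) {D : ι → Set G}
    (hD : ∀ d, MeasurableSet (D d)) (hcov : ∀ x, ∃ d, x ∈ D d) (F : G → ℝ≥0∞) :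
    ∫⁻ x, F x ∂μ ≤ ∑' d, μ (D d) * ⨆ x ∈ D d, F x := by
  have hU : (⋃ d, D d) = univ := Set.iUnion_eq_univ_iff.2 hcov
  calc ∫⁻ x, F x ∂μ = ∫⁻ x in ⋃ d, D d, F x ∂μ := by rw [hU, Measure.restrict_univ]
    _ ≤ ∑' d, ∫⁻ x in D d, F x ∂μ := lintegral_iUnion_le D F
    _ ≤ ∑' d, μ (D d) * ⨆ x ∈ D d, F x := by
        refine ENNReal.tsum_le_tsum fun d => ?_
        calc ∫⁻ x in D d, F x ∂μ ≤ ∫⁻ _ in D d, ⨆ y ∈ D d, F y ∂μ :=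
              setLIntegral_mono' (hD d) fun x hx => le_iSup₂ (f := fun (y : G) (_ : y ∈ D d) => F y) x hx
          _ = μ (D d) * ⨆ y ∈ D d, F y := by rw [setLIntegral_const, mul_comm]

variable [Group G]

/-- The conjugate-membership set `{g | x g x⁻¹ ∈ S}` is measurable for measurable `S`. [folklore] -/
theorem measurableSet_conj_mem [MeasurableMul G] {S : Set G} (hS : MeasurableSet S) (x : G) :
    MeasurableSet {g : G | x * g * x⁻¹ ∈ S} :=
  ((measurable_id.const_mul x).mul_const x⁻¹) hS

/-- **FIBRE BOUND `∫_{g ∈ A} β(x g x⁻¹) dμ(g) ≤ M_b · μ(A ∩ {g | x g x⁻¹ ∈ S})`** for `β ≤ M_b` vanishing off `S` (`S` measurable; any `A`, any `x`). [folklore] -/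
theorem setLIntegral_conj_le_mul_measure [MeasurableMul G] (μ : Measure G) (A : Set G) {S : Set G} (hS : MeasurableSet S)
    {β : G → ℝ≥0∞} {Mb : ℝ≥0∞} (hβM : ∀ g, β g ≤ Mb) (hβS : ∀ g, β g ≠ 0 → g ∈ S) (x : G) :
    ∫⁻ g in A, β (x * g * x⁻¹) ∂μ ≤ Mb * μ (A ∩ {g : G | x * g * x⁻¹ ∈ S}) := by
  have hm : MeasurableSet {g : G | x * g * x⁻¹ ∈ S} := measurableSet_conj_mem hS x
  calc ∫⁻ g in A, β (x * g * x⁻¹) ∂μ ≤ ∫⁻ g in A, {g : G | x * g * x⁻¹ ∈ S}.indicator (fun _ => Mb) g ∂μ := by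
        refine lintegral_mono fun g => ?_
        by_cases hg : x * g * x⁻¹ ∈ S
        · rw [Set.indicator_of_mem (show g ∈ {g : G | x * g * x⁻¹ ∈ S} from hg)]; exact hβM _
        · have h0 : β (x * g * x⁻¹) = 0 := by
            by_contra h; exact hg (hβS _ h)
          rw [h0]; exact zero_le
    _ = Mb * μ (A ∩ {g : G | x * g * x⁻¹ ∈ S}) := by
        rw [lintegral_indicator_const hm, Measure.restrict_apply hm, Set.inter_comm]

/-- **TONELLI `∫_{g ∈ A} ∫_x β(x g x⁻¹) dμ(x) dμ(g) = ∫_x ∫_{g ∈ A} β(x g x⁻¹) dμ(g) dμ(x)`** (`β` measurable, `μ` s-finite, multiplication and inversion measurable).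
[cite: Folland1995, §2.2] -/
theorem setLIntegral_lintegral_conj_eq [MeasurableMul₂ G] [MeasurableInv G] (μ : Measure G) [SFinite μ] (A : Set G)
    {β : G → ℝ≥0∞} (hβ : Measurable β) :
    ∫⁻ g in A, ∫⁻ x, β (x * g * x⁻¹) ∂μ ∂μ = ∫⁻ x, ∫⁻ g in A, β (x * g * x⁻¹) ∂μ ∂μ := by
  have hF : Measurable (uncurry fun (g : G) (x : G) => β (x * g * x⁻¹)) :=
    hβ.comp ((measurable_snd.mul measurable_fst).mul measurable_snd.inv)
  exact lintegral_lintegral_swap hF.aemeasurable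

/-- **`∫_{A} ∫_G β(x g x⁻¹) dμ(x) dμ(g) ≤ ∫_x M_b · μ(A ∩ {g | x g x⁻¹ ∈ S}) dμ(x)`** (Tonelli + the fibre bound). [folklore] -/
theorem setLIntegral_lintegral_conj_le [MeasurableMul₂ G] [MeasurableInv G] (μ : Measure G) [SFinite μ] (A : Set G)
    {S : Set G} (hS : MeasurableSet S) {β : G → ℝ≥0∞} (hβ : Measurable β) {Mb : ℝ≥0∞} (hβM : ∀ g, β g ≤ Mb) (hβS : ∀ g, β g ≠ 0 → g ∈ S) :
    ∫⁻ g in A, ∫⁻ x, β (x * g * x⁻¹) ∂μ ∂μ ≤ ∫⁻ x, Mb * μ (A ∩ {g : G | x * g * x⁻¹ ∈ S}) ∂μ := by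
  rw [setLIntegral_lintegral_conj_eq μ A hβ]
  exact lintegral_mono fun x => setLIntegral_conj_le_mul_measure μ A hS hβM hβS x

/-- **STEP (i) OF (R15-1) — `∫_{A} ∫_G β(x g x⁻¹) dμ(x) dμ(g) ≤ M_b · Σ_d μ(D_d) · ⨆_{x ∈ D_d} μ(A ∩ {g | x g x⁻¹ ∈ S})`** for a countable measurable cover
`⋃_d D_d = G` (the Cartan double cosets `K₀ t_d K₀`), `β ≤ M_b` measurable vanishing off the measurable `S` (`= supp β`), `A` any set (`= C ∩ Φ_β`), `μ` s-finite.
[cite: Helgason2000, Ch. I §5] -/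
theorem setLIntegral_lintegral_conj_le_tsum {ι : Type*} [Countable ι] [MeasurableMul₂ G] [MeasurableInv G] (μ : Measure G) [SFinite μ]
    {D : ι → Set G} (hD : ∀ d, MeasurableSet (D d)) (hcov : ∀ x, ∃ d, x ∈ D d) (A : Set G)
    {S : Set G} (hS : MeasurableSet S) {β : G → ℝ≥0∞} (hβ : Measurable β) {Mb : ℝ≥0∞} (hβM : ∀ g, β g ≤ Mb) (hβS : ∀ g, β g ≠ 0 → g ∈ S) :
    ∫⁻ g in A, ∫⁻ x, β (x * g * x⁻¹) ∂μ ∂μ ≤ Mb * ∑' d, μ (D d) * ⨆ x ∈ D d, μ (A ∩ {g : G | x * g * x⁻¹ ∈ S}) := by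
  refine (setLIntegral_lintegral_conj_le μ A hS hβ hβM hβS).trans ?_
  refine (lintegral_le_tsum_measure_mul_iSup_mem μ hD hcov _).trans (le_of_eq ?_)
  rw [← ENNReal.tsum_mul_left]
  refine tsum_congr fun d => ?_
  have key : (⨆ x ∈ D d, Mb * μ (A ∩ {g : G | x * g * x⁻¹ ∈ S})) = Mb * ⨆ x ∈ D d, μ (A ∩ {g : G | x * g * x⁻¹ ∈ S}) := by
    rw [ENNReal.mul_iSup]
    refine iSup_congr fun x => ?_
    rw [ENNReal.mul_iSup]
  rw [key, mul_left_comm]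

end Summit.HodgeConjecture.HodgeConjecture.Cruxes.H413.K2E3ConjFibreCoverSkeleton

end
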